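import Mathlib
import Literature.RingTheory.CohomologyAnnihilator.TowerBasic
import Literature.RingTheory.CohomologyAnnihilator.RegularLocalRing
import Summits.ResolutionOfSingularities.ResolutionOfSingularities.Theorems.HomologicalConductorPersistenceSurfaceSaturationHypersurfaceSectionLift
import Summits.ResolutionOfSingularities.ResolutionOfSingularities.Theorems.HomologicalConductorPersistenceSurfaceSaturationGorenstein
import HarnessLib

/-!
# Rung S-2 `PersistenceSurface` (stmt-ResolutionOfSingularities-19970) — CHANGE OF RINGS across a hypersurface
# section: `Extʲ_S(·, S) = 0 (j ≥ n+1)` ⇒ `Extⁱ_{S/(x)}(·, S/(x)) = 0 (i ≥ n)`, and `Sat₃` at complete-intersection stages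

Route `ResolutionOfSingularities/HomologicalConductor`, chain W4.4b, rung S-2 `PersistenceSurface`
(stmt-ResolutionOfSingularities-19970), registered skeleton 1a77c002, stub
`stub_saturationFourSurfaceResidualFour : SaturationFourSurfaceResidual₄`.  [OURS · pure homological algebra;
AI-written, weaker than expert review; NOT a statement of the manuscript under study (Hironaka 2017).]  DEF-FREE.

This discharges the Gorenstein input `hGor` of `…PersistenceSurfaceSaturationGorenstein` (p794975:
`∀ W f.g., ∀ i ≥ 3, Extⁱ_T(W, T) = 0 ⇒ ca(T) = ca³(T)`) at COMPLETE-INTERSECTION stages, by the vanishing half of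
Rees' change-of-rings lemma [Bruns–Herzog, Lemma 3.1.16] — the self-injective dimension drops by one modulo a
non-zero-divisor — assembled from the lifting lemma of `…HypersurfaceSectionLift` (p796351):

* `ext_eq_zero_of_shortExact_of_ext_eq_zero` — downward shift with an acyclic middle;
* `ext_restrict_free_eq_zero` — for `x` regular and `T := S ⧸ (x)`: `Extʲ_S(Tᵐ, S) = 0` for `j ≥ 2`
  (`0 → Sᵐ —x→ Sᵐ → Tᵐ → 0`);
* **`ext_quotient_eq_zero_of_ext_eq_zero`** — `S` noetherian, `x` regular, `n ≥ 1`: if `Extʲ_S(W', S) = 0` for all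
  finitely generated `S`-modules `W'` and all `j ≥ n + 1`, then `Extⁱ_T(W, T) = 0` for all finitely generated
  `T`-modules `W` and all `i ≥ n` (induction on `i` along a finite free `T`-resolution; base case = the lifting lemma);
* `ext_eq_zero_of_isRegularLocalRing` — base: `S` regular local of dimension `d` ⇒ `Extʲ_S(W', S) = 0` for `j ≥ d + 1`
  (tree `cohomologyAnnihilatorOfDegree_eq_top_of_isRegularLocalRing`);
* `ext_hypersurface_eq_zero_of_isRegularLocalRing`, `ext_codimTwo_eq_zero_of_isRegularLocalRing` — one and two
  sections: `S` regular local of dimension `d + 1` (resp. `d + 2`) ⇒ the vanishing at level `d + 1` for `S ⧸ (x₁)`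
  (resp. `(S ⧸ (x₁)) ⧸ (x₂)`, `x₂` regular on `S ⧸ (x₁)`);
* **`cohomologyAnnihilator_eq_three_codimTwo`** — `Sat₃`: for `S` regular local of dimension `4` and such `x₁, x₂` with
  `(S ⧸ (x₁)) ⧸ (x₂)` a domain, `ca = ca³` there; any stage PRESENTED as such a ring gets `ca T ⊆ caAt n T` (`n ≥ 3`)
  from `PersistenceSurfaceSaturationGorenstein.ca_subset_caAt_of_ringEquiv_of_ext_eq_zero` (p795661) — e.g. the
  specimen chart `U_x(E₁₂) = k[z,p,q,r]/(pq + r²z + z², pr − q²)` localised, once presented.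

References: W. Bruns, J. Herzog, *Cohen–Macaulay rings*, rev. ed. 1998, Lemma 3.1.16, Prop. 3.1.19
[`BrunsHerzog1998`]; S. B. Iyengar, R. Takahashi, IMRN 2016, §2 [`IyengarTakahashi2014`] (mechanism only).
-/

noncomputable section

-- single-problem summit: the doubled namespace component `ResolutionOfSingularities` is forced
set_option linter.dupNamespace false

namespace Summit.ResolutionOfSingularities.ResolutionOfSingularities.Theorems.HomologicalConductor.PersistenceSurfaceSaturationHypersurfaceSectionExt

open CategoryTheory CategoryTheory.Abelian Literature.RingTheory.CohomologyAnnihilator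
open Summit.ResolutionOfSingularities.ResolutionOfSingularities.Theorems.HomologicalConductor.PersistenceSurfaceSaturationHypersurfaceSectionLift
open Summit.ResolutionOfSingularities.ResolutionOfSingularities.Theorems.HomologicalConductor.PersistenceSurfaceSaturationGorenstein

universe u

/-! ## Downward shift with an acyclic middle -/

section Shift

variable {R : Type u} [CommRing R]

/-- **Downward degree shift with an acyclic middle**: for `0 → K → P → K' → 0` short exact, if `Extʲ(P, L) = 0` and
`Extʲ⁺¹(K', L) = 0` then `Extʲ(K, L) = 0`. [folklore] -/
theorem ext_eq_zero_of_shortExact_of_ext_eq_zero {K P K' : ModuleCat.{u} R} {f : K ⟶ P} {g : P ⟶ K'}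
    {w : f ≫ g = 0} (hS : (ShortComplex.mk f g w).ShortExact) (L : ModuleCat.{u} R) {j : ℕ}
    (hP : ∀ e : Ext.{u} P L j, e = 0) (hK' : ∀ e : Ext.{u} K' L (j + 1), e = 0) (e : Ext.{u} K L j) : e = 0 := by
  have hδ : hS.extClass.comp e (add_comm 1 j) = 0 := hK' _
  obtain ⟨x₂, hx₂⟩ := Ext.contravariant_sequence_exact₁ hS L e (add_comm 1 j) hδ
  rw [← hx₂, hP x₂, Ext.comp_zero]

end Shift

/-! ## The `S`-side: restrictions of free `S/(x)`-modules have projective dimension `≤ 1` -/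

section Free

variable {S : Type u} [CommRing S]

/-- **`Extʲ_S(Tᵐ, S) = 0` for `j ≥ 2`**, `T := S ⧸ (x)`, `x` a non-zero-divisor: from the short exact sequence of
`S`-modules `0 → Sᵐ —x→ Sᵐ → Tᵐ → 0` with free outer terms (any `L` in place of `S`).
[cite: BrunsHerzog1998, Lemma 3.1.16] -/
theorem ext_restrict_free_eq_zero {x : S} (hx : IsSMulRegular S x) (m : ℕ) (L : ModuleCat.{u} S) {j : ℕ}
    (hj : 2 ≤ j) (e : Ext.{u} (ModuleCat.of S (Fin m → S ⧸ Ideal.span ({x} : Set S))) L j) : e = 0 := by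
  -- the reduction `p : Sᵐ → Tᵐ` and multiplication by `x` on `Sᵐ`
  let p : (Fin m → S) →ₗ[S] (Fin m → S ⧸ Ideal.span ({x} : Set S)) :=
    (Algebra.linearMap S (S ⧸ Ideal.span ({x} : Set S))).compLeft (Fin m)
  have hp : ∀ (v : Fin m → S) (i : Fin m), p v i = Ideal.Quotient.mk (Ideal.span ({x} : Set S)) (v i) :=
    fun v i => rfl
  have hinj : Function.Injective (LinearMap.lsmul S (Fin m → S) x) := by
    intro a b h
    ext i
    exact hx (congr_fun h i)
  have hsurj : Function.Surjective p := by
    intro w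
    choose g hg using fun i => Ideal.Quotient.mk_surjective (w i)
    exact ⟨g, funext fun i => by rw [hp, hg]⟩
  have hexact : Function.Exact (LinearMap.lsmul S (Fin m → S) x) p := by
    intro v
    constructor
    · intro hv
      have hvi : ∀ i, ∃ a : S, a * x = v i := fun i => by
        have := congr_fun hv i
        rw [hp, Pi.zero_apply, Ideal.Quotient.eq_zero_iff_mem] at this
        exact Ideal.mem_span_singleton'.mp this
      choose a ha using hvi
      exact ⟨a, funext fun i => by rw [LinearMap.lsmul_apply, Pi.smul_apply, smul_eq_mul, mul_comm, ha]⟩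
    · rintro ⟨a, rfl⟩
      ext i
      rw [hp, LinearMap.lsmul_apply, Pi.smul_apply, Pi.zero_apply, Ideal.Quotient.eq_zero_iff_mem, smul_eq_mul]
      exact Ideal.mul_mem_right _ _ (Ideal.subset_span rfl)
  obtain ⟨w, hSh⟩ := exists_shortExact_of_linearMap (Y := ModuleCat.of S (Fin m → S))
    (M := ModuleCat.of S (Fin m → S)) (X := ModuleCat.of S (Fin m → S ⧸ Ideal.span ({x} : Set S)))
    (LinearMap.lsmul S (Fin m → S) x) p hinj hsurj hexact
  obtain ⟨j', rfl⟩ : ∃ j', j = j' + 1 + 1 := ⟨j - 2, by omega⟩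
  haveI : Projective (ModuleCat.of S (Fin m → S)) :=
    (IsProjective.iff_projective (R := S) (Fin m → S)).mp inferInstance
  exact ext_succ_eq_zero_of_shortExact_projective hSh inferInstance L
    (fun e' => Ext.eq_zero_of_projective e') e

end Free

/-! ## The change of rings -/

section ChangeOfRings

variable {S : Type u} [CommRing S] [IsNoetherianRing S]

/-- **The induction behind the change of rings** (types with compatible `S`- and `T`-structures, `T := S ⧸ (x)`):
for `i ≥ 1` and every finitely generated `T`-module `W` with `Extʲ_S(W, S) = 0` for all `j ≥ i + 1`, `Extⁱ_T(W, T) = 0`.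
Base `i = 1`: a free cover `0 → K → Tᵐ → W → 0`, `K_S := p⁻¹(K) = Ω¹_S(W)`, `Ext¹_S(K_S, S) = Ext²_S(W, S) = 0`, the
lifting lemma, and «extension property ⇒ `Ext¹ = 0`».  Step: `Extʲ_S(K, S) = 0` for `j ≥ i + 1` (shift along the
cover, `Extʲ_S(Tᵐ, S) = 0` for `j ≥ 2`), induction, and the upward shift on the `T` side.
[cite: BrunsHerzog1998, Lemma 3.1.16] -/
theorem ext_quotient_eq_zero_aux {x : S} (hx : IsSMulRegular S x) :
    ∀ (k : ℕ) (W : Type u) [AddCommGroup W] [Module (S ⧸ Ideal.span ({x} : Set S)) W] [Module S W]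
      [IsScalarTower S (S ⧸ Ideal.span ({x} : Set S)) W],
      Module.Finite (S ⧸ Ideal.span ({x} : Set S)) W →
      (∀ j : ℕ, k + 2 ≤ j → ∀ e : Ext.{u} (ModuleCat.of S W) (ModuleCat.of S S) j, e = 0) →
      ∀ e : Ext.{u} (ModuleCat.of (S ⧸ Ideal.span ({x} : Set S)) W)
        (ModuleCat.of (S ⧸ Ideal.span ({x} : Set S)) (S ⧸ Ideal.span ({x} : Set S))) (k + 1), e = 0 := by
  intro k
  induction k with
  | zero =>
    intro W _ _ _ _ hW hS e
    haveI := hW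
    -- a free cover of `W` over `T`
    obtain ⟨m, q, hq⟩ := Module.Finite.exists_fin' (S ⧸ Ideal.span ({x} : Set S)) W
    let K : Submodule (S ⧸ Ideal.span ({x} : Set S)) (Fin m → S ⧸ Ideal.span ({x} : Set S)) := LinearMap.ker q
    -- the `T`-side short exact sequence `0 → K → Tᵐ → W → 0`
    obtain ⟨wT, hT⟩ := exists_shortExact_of_linearMap
      (Y := ModuleCat.of (S ⧸ Ideal.span ({x} : Set S)) K)
      (M := ModuleCat.of (S ⧸ Ideal.span ({x} : Set S)) (Fin m → S ⧸ Ideal.span ({x} : Set S)))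
      (X := ModuleCat.of (S ⧸ Ideal.span ({x} : Set S)) W)
      K.subtype q K.injective_subtype hq (LinearMap.exact_subtype_ker_map q)
    have hproj : Projective (ModuleCat.of (S ⧸ Ideal.span ({x} : Set S)) (Fin m → S ⧸ Ideal.span ({x} : Set S))) :=
      (IsProjective.iff_projective (R := S ⧸ Ideal.span ({x} : Set S)) (Fin m → S ⧸ Ideal.span ({x} : Set S))).mp
        inferInstance
    -- the reduction `p : Sᵐ → Tᵐ` and the `S`-side sequence `0 → K_S → Sᵐ → W → 0`
    let p : (Fin m → S) →ₗ[S] (Fin m → S ⧸ Ideal.span ({x} : Set S)) :=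
      (Algebra.linearMap S (S ⧸ Ideal.span ({x} : Set S))).compLeft (Fin m)
    have hp : ∀ (v : Fin m → S) (i : Fin m), p v i = Ideal.Quotient.mk (Ideal.span ({x} : Set S)) (v i) :=
      fun v i => rfl
    have hpsurj : Function.Surjective p := by
      intro w'
      choose g hg using fun i => Ideal.Quotient.mk_surjective (w' i)
      exact ⟨g, funext fun i => by rw [hp, hg]⟩
    have hker : LinearMap.ker ((q.restrictScalars S) ∘ₗ p) = (K.restrictScalars S).comap p := by
      rw [LinearMap.ker_comp, LinearMap.ker_restrictScalars]
    obtain ⟨wS, hSS⟩ := exists_shortExact_of_linearMap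
      (Y := ModuleCat.of S ((K.restrictScalars S).comap p)) (M := ModuleCat.of S (Fin m → S))
      (X := ModuleCat.of S W) (((K.restrictScalars S).comap p).subtype) ((q.restrictScalars S) ∘ₗ p)
      (Submodule.injective_subtype _) (hq.comp hpsurj) (by
        rw [← hker]
        exact LinearMap.exact_subtype_ker_map _)
    have hprojS : Projective (ModuleCat.of S (Fin m → S)) :=
      (IsProjective.iff_projective (R := S) (Fin m → S)).mp inferInstance
    -- `Ext¹_S(K_S, S) = 0` from `Ext²_S(W, S) = 0`
    have hKS : ∀ e' : Ext.{u} (ModuleCat.of S ((K.restrictScalars S).comap p)) (ModuleCat.of S S) 1, e' = 0 :=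
      fun e' => ext_eq_zero_of_shortExact_projective hSS hprojS (ModuleCat.of S S) le_rfl
        (fun e'' => hS 2 le_rfl e'') e'
    -- every `φ : K → T` extends to `Tᵐ`
    have hext : ∀ φ : (ModuleCat.of (S ⧸ Ideal.span ({x} : Set S)) K ⟶
        ModuleCat.of (S ⧸ Ideal.span ({x} : Set S)) (S ⧸ Ideal.span ({x} : Set S))),
        ∃ ψ : (ModuleCat.of (S ⧸ Ideal.span ({x} : Set S)) (Fin m → S ⧸ Ideal.span ({x} : Set S)) ⟶
          ModuleCat.of (S ⧸ Ideal.span ({x} : Set S)) (S ⧸ Ideal.span ({x} : Set S))),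
          ModuleCat.ofHom K.subtype ≫ ψ = φ := by
      intro φ
      obtain ⟨ψ, hψ⟩ := exists_extension_of_ext_one_eq_zero hx p hp K φ.hom hKS
      refine ⟨ModuleCat.ofHom ψ, ?_⟩
      ext k
      simpa [ModuleCat.hom_comp] using hψ k
    exact ext_one_eq_zero_of_forall_exists_extension hT hproj _ hext e
  | succ k ih =>
    intro W _ _ _ _ hW hS e
    haveI := hW
    obtain ⟨m, q, hq⟩ := Module.Finite.exists_fin' (S ⧸ Ideal.span ({x} : Set S)) W
    let K : Submodule (S ⧸ Ideal.span ({x} : Set S)) (Fin m → S ⧸ Ideal.span ({x} : Set S)) := LinearMap.ker q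
    haveI : Module.Finite (S ⧸ Ideal.span ({x} : Set S)) K := Module.IsNoetherian.finite _ _
    -- `T`-side and `S`-side short exact sequences `0 → K → Tᵐ → W → 0`
    obtain ⟨wT, hT⟩ := exists_shortExact_of_linearMap
      (Y := ModuleCat.of (S ⧸ Ideal.span ({x} : Set S)) K)
      (M := ModuleCat.of (S ⧸ Ideal.span ({x} : Set S)) (Fin m → S ⧸ Ideal.span ({x} : Set S)))
      (X := ModuleCat.of (S ⧸ Ideal.span ({x} : Set S)) W)
      K.subtype q K.injective_subtype hq (LinearMap.exact_subtype_ker_map q)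
    have hproj : Projective (ModuleCat.of (S ⧸ Ideal.span ({x} : Set S)) (Fin m → S ⧸ Ideal.span ({x} : Set S))) :=
      (IsProjective.iff_projective (R := S ⧸ Ideal.span ({x} : Set S)) (Fin m → S ⧸ Ideal.span ({x} : Set S))).mp
        inferInstance
    obtain ⟨wS, hSS⟩ := exists_shortExact_of_linearMap (Y := ModuleCat.of S K)
      (M := ModuleCat.of S (Fin m → S ⧸ Ideal.span ({x} : Set S))) (X := ModuleCat.of S W)
      (K.subtype.restrictScalars S) (q.restrictScalars S) K.injective_subtype hq
      (LinearMap.exact_subtype_ker_map q)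
    -- `Extʲ_S(K, S) = 0` for `j ≥ k + 2`
    have hKS : ∀ j : ℕ, k + 2 ≤ j → ∀ e' : Ext.{u} (ModuleCat.of S K) (ModuleCat.of S S) j, e' = 0 :=
      fun j hj e' => ext_eq_zero_of_shortExact_of_ext_eq_zero hSS (ModuleCat.of S S)
        (fun e'' => ext_restrict_free_eq_zero hx m (ModuleCat.of S S) (by omega) e'')
        (fun e'' => hS (j + 1) (by omega) e'') e'
    have hK := ih K inferInstance hKS
    exact ext_succ_eq_zero_of_shortExact_projective hT hproj _ hK e

/-- **CHANGE OF RINGS across a hypersurface section (vanishing half of Rees' lemma).**  `S` noetherian, `x ∈ S` a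
non-zero-divisor, `T := S ⧸ (x)`, `n ≥ 1`: if `Extʲ_S(W', S) = 0` for every finitely generated `S`-module `W'` and
every `j ≥ n + 1`, then `Extⁱ_T(W, T) = 0` for every finitely generated `T`-module `W` and every `i ≥ n` — the
self-injective dimension drops by one. [cite: BrunsHerzog1998, Lemma 3.1.16] -/
theorem ext_quotient_eq_zero_of_ext_eq_zero {x : S} (hx : IsSMulRegular S x) {n : ℕ} (hn : 1 ≤ n)
    (hS : ∀ (W' : ModuleCat.{u} S), Module.Finite S W' → ∀ j : ℕ, n + 1 ≤ j →
      ∀ e : Ext.{u} W' (ModuleCat.of S S) j, e = 0)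
    (W : ModuleCat.{u} (S ⧸ Ideal.span ({x} : Set S))) (hW : Module.Finite (S ⧸ Ideal.span ({x} : Set S)) W)
    {i : ℕ} (hi : n ≤ i)
    (e : Ext.{u} W (ModuleCat.of (S ⧸ Ideal.span ({x} : Set S)) (S ⧸ Ideal.span ({x} : Set S))) i) : e = 0 := by
  letI : Module S W := Module.compHom W (Ideal.Quotient.mk (Ideal.span ({x} : Set S)))
  haveI : IsScalarTower S (S ⧸ Ideal.span ({x} : Set S)) W :=
    IsScalarTower.of_algebraMap_smul fun _ _ => rfl
  haveI := hW
  haveI : Module.Finite S W := Module.Finite.trans (S ⧸ Ideal.span ({x} : Set S)) W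
  obtain ⟨k, rfl⟩ : ∃ k, i = k + 1 := ⟨i - 1, by omega⟩
  exact ext_quotient_eq_zero_aux hx k W hW
    (fun j hj e' => hS (ModuleCat.of S W) inferInstance j (by omega) e') e

end ChangeOfRings

/-! ## Regular base and complete-intersection sections -/

section CompleteIntersection

variable {S : Type u} [CommRing S]

/-- **Base: a regular local ring of dimension `d` has `Extʲ_S(W', S) = 0` for `j ≥ d + 1`** (`caᵈ⁺¹(S) = S`, tree
`cohomologyAnnihilatorOfDegree_eq_top_of_isRegularLocalRing`). [cite: BrunsHerzog1998, Prop. 3.1.19] -/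
theorem ext_eq_zero_of_isRegularLocalRing [IsRegularLocalRing S] {d : ℕ} (hd : ringKrullDim S = d)
    (W' : ModuleCat.{u} S) (hW' : Module.Finite S W') {j : ℕ} (hj : d + 1 ≤ j)
    (e : Ext.{u} W' (ModuleCat.of S S) j) : e = 0 := by
  haveI := hW'
  have h1 : (1 : S) ∈ cohomologyAnnihilatorOfDegree S (d + 1) := by
    rw [cohomologyAnnihilatorOfDegree_eq_top_of_isRegularLocalRing S hd]
    trivial
  have := mem_cohomologyAnnihilatorOfDegree_iff.mp h1 j hj W' (ModuleCat.of S S) inferInstance inferInstance e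
  rwa [one_smul] at this

/-- **One section**: `S` regular local of dimension `d + 1`, `x₁` a non-zero-divisor ⇒ `Extⁱ_{S/(x₁)}(W, S/(x₁)) = 0` for
all finitely generated `W` and all `i ≥ d + 1`. [cite: BrunsHerzog1998, Lemma 3.1.16, Prop. 3.1.19] -/
theorem ext_hypersurface_eq_zero_of_isRegularLocalRing [IsRegularLocalRing S] {d : ℕ}
    (hd : ringKrullDim S = (d + 1 : ℕ)) {x₁ : S} (hx₁ : IsSMulRegular S x₁)
    (W : ModuleCat.{u} (S ⧸ Ideal.span ({x₁} : Set S))) (hW : Module.Finite (S ⧸ Ideal.span ({x₁} : Set S)) W)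
    {i : ℕ} (hi : d + 1 ≤ i)
    (e : Ext.{u} W (ModuleCat.of (S ⧸ Ideal.span ({x₁} : Set S)) (S ⧸ Ideal.span ({x₁} : Set S))) i) : e = 0 :=
  ext_quotient_eq_zero_of_ext_eq_zero hx₁ (n := d + 1) (by omega)
    (fun W' hW' j hj e' => ext_eq_zero_of_isRegularLocalRing hd W' hW' (by omega) e') W hW hi e

/-- **Two sections (codimension-two complete intersections)**: `S` regular local of dimension `d + 2`, `x₁` a
non-zero-divisor of `S`, `x₂` a non-zero-divisor of `S/(x₁)` ⇒ `Extⁱ(W, T) = 0` over `T := (S/(x₁))/(x₂)` for all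
finitely generated `W` and all `i ≥ d + 1`. [cite: BrunsHerzog1998, Lemma 3.1.16, Prop. 3.1.19] -/
theorem ext_codimTwo_eq_zero_of_isRegularLocalRing [IsRegularLocalRing S] {d : ℕ}
    (hd : ringKrullDim S = (d + 2 : ℕ)) {x₁ : S} (hx₁ : IsSMulRegular S x₁)
    {x₂ : S ⧸ Ideal.span ({x₁} : Set S)} (hx₂ : IsSMulRegular (S ⧸ Ideal.span ({x₁} : Set S)) x₂)
    (W : ModuleCat.{u} ((S ⧸ Ideal.span ({x₁} : Set S)) ⧸ Ideal.span ({x₂} : Set (S ⧸ Ideal.span ({x₁} : Set S)))))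
    (hW : Module.Finite ((S ⧸ Ideal.span ({x₁} : Set S)) ⧸ Ideal.span ({x₂} : Set (S ⧸ Ideal.span ({x₁} : Set S)))) W)
    {i : ℕ} (hi : d + 1 ≤ i)
    (e : Ext.{u} W (ModuleCat.of _ ((S ⧸ Ideal.span ({x₁} : Set S)) ⧸
      Ideal.span ({x₂} : Set (S ⧸ Ideal.span ({x₁} : Set S))))) i) : e = 0 :=
  ext_quotient_eq_zero_of_ext_eq_zero hx₂ (n := d + 1) (by omega)
    (fun W' hW' j hj e' => ext_hypersurface_eq_zero_of_isRegularLocalRing (d := d + 1)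
      (by rw [hd]) hx₁ W' hW' (by omega) e') W hW hi e

/-- **`Sat₃` at a codimension-two complete-intersection surface ring**: `S` regular local of dimension `4`, `x₁`
regular on `S`, `x₂` regular on `S/(x₁)`, and `T := (S/(x₁))/(x₂)` a domain ⇒ `ca(T) = ca³(T)`
(`PersistenceSurfaceSaturationGorenstein.cohomologyAnnihilator_eq_three_of_ext_eq_zero`).  A stage presented as such a
`T` gets `ca ⊆ caAt n` (`n ≥ 3`) by `ca_subset_caAt_of_ringEquiv_of_ext_eq_zero`.
[cite: BrunsHerzog1998, Thm. 3.3.10; IyengarTakahashi2014, §2] -/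
theorem cohomologyAnnihilator_eq_three_codimTwo [IsRegularLocalRing S] (hd : ringKrullDim S = (4 : ℕ))
    {x₁ : S} (hx₁ : IsSMulRegular S x₁)
    {x₂ : S ⧸ Ideal.span ({x₁} : Set S)} (hx₂ : IsSMulRegular (S ⧸ Ideal.span ({x₁} : Set S)) x₂)
    [IsDomain ((S ⧸ Ideal.span ({x₁} : Set S)) ⧸ Ideal.span ({x₂} : Set (S ⧸ Ideal.span ({x₁} : Set S))))] :
    cohomologyAnnihilator ((S ⧸ Ideal.span ({x₁} : Set S)) ⧸ Ideal.span ({x₂} : Set (S ⧸ Ideal.span ({x₁} : Set S)))) =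
      cohomologyAnnihilatorOfDegree
        ((S ⧸ Ideal.span ({x₁} : Set S)) ⧸ Ideal.span ({x₂} : Set (S ⧸ Ideal.span ({x₁} : Set S)))) 3 :=
  cohomologyAnnihilator_eq_three_of_ext_eq_zero fun W hW _ hi e =>
    ext_codimTwo_eq_zero_of_isRegularLocalRing (d := 2) hd hx₁ hx₂ W hW hi e

end CompleteIntersection

/-! ## Route vocabulary: `Sat₄` at a stage PRESENTED as a codimension-two complete intersection (appended) -/

section Stage

variable {k K : Type u} [Field k] [Field K] [Algebra k K]

/-- **`Satₙ` (`n ≥ 3`) at a stage presented as a codimension-two complete-intersection surface ring.**  For a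
subalgebra stage `T ⊆ K` with a ring isomorphism `e : ↥T ≃+* (S ⧸ (x₁)) ⧸ (x₂)`, `S` regular local of Krull dimension
`4`, `x₁` a non-zero-divisor of `S`, `x₂` a non-zero-divisor of `S ⧸ (x₁)`: the route's inline sets satisfy
`ca T ⊆ caAt n T` for every `n ≥ 3` — in particular the `m`-th conjunct `ca ⊆ caAt 4` of `SaturationFourSurfaceResidual₄`
at such a stage (`ext_codimTwo_eq_zero_of_isRegularLocalRing` + `ca_subset_caAt_of_ringEquiv_of_ext_eq_zero`; the target
is a domain because `↥T` is).  The presentation `e` is the consumer's input (e.g. the chart `U_x(E₁₂)`).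
[cite: BrunsHerzog1998, Lemma 3.1.16, Thm. 3.3.10; IyengarTakahashi2014, §2] -/
theorem ca_subset_caAt_of_ringEquiv_codimTwo (T : Subalgebra k K) {S : Type u} [CommRing S] [IsRegularLocalRing S]
    (hd : ringKrullDim S = (4 : ℕ)) {x₁ : S} (hx₁ : IsSMulRegular S x₁)
    {x₂ : S ⧸ Ideal.span ({x₁} : Set S)} (hx₂ : IsSMulRegular (S ⧸ Ideal.span ({x₁} : Set S)) x₂)
    (e : ↥T ≃+* (S ⧸ Ideal.span ({x₁} : Set S)) ⧸ Ideal.span ({x₂} : Set (S ⧸ Ideal.span ({x₁} : Set S))))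
    {n : ℕ} (hn : 3 ≤ n) :
    {x : K | ∃ hx : x ∈ T, ∃ m : ℕ, ∀ i : ℕ, m ≤ i → ∀ (M N : ModuleCat.{u} ↥T),
        Module.Finite ↥T M → Module.Finite ↥T N →
          ∀ e : CategoryTheory.Abelian.Ext.{u} M N i, (⟨x, hx⟩ : ↥T) • e = 0} ⊆
      {x : K | ∃ hx : x ∈ T, ∀ i : ℕ, n ≤ i → ∀ (M N : ModuleCat.{u} ↥T),
        Module.Finite ↥T M → Module.Finite ↥T N →
          ∀ e : CategoryTheory.Abelian.Ext.{u} M N i, (⟨x, hx⟩ : ↥T) • e = 0} := by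
  haveI : IsDomain ((S ⧸ Ideal.span ({x₁} : Set S)) ⧸ Ideal.span ({x₂} : Set (S ⧸ Ideal.span ({x₁} : Set S)))) :=
    MulEquiv.isDomain ↥T e.symm.toMulEquiv
  exact ca_subset_caAt_of_ringEquiv_of_ext_eq_zero T e
    (fun W hW _ hi e' => ext_codimTwo_eq_zero_of_isRegularLocalRing (d := 2) hd hx₁ hx₂ W hW hi e') hn

end Stage

end Summit.ResolutionOfSingularities.ResolutionOfSingularities.Theorems.HomologicalConductor.PersistenceSurfaceSaturationHypersurfaceSectionExt

end
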